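import Mathlib
import HarnessLib
import Literature.Analysis.FluidPDE.SuitableWeak
import Literature.Analysis.FluidPDE.LocalTypeI
import Literature.Analysis.FluidPDE.ElgindiBlowup
import Literature.Analysis.FluidPDE.FlatSwirlGauge
import Literature.Analysis.FluidPDE.CaloricLocalLerayLp
import Literature.Analysis.FluidPDE.NSSuitableESSProofs
import Literature.Analysis.FluidPDE.NSVorticityOfSmoothRepresentative
import Literature.Analysis.FluidPDE.TaoEnstrophyLocalisation
import Summits.NavierStokesRegularity.NavierStokesRegularity.Theses.QuarterBudgetTrace
import Summits.NavierStokesRegularity.NavierStokesRegularity.Theorems.TerminalTraceTypeITraceScarL3LoudDustPerfect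
import Summits.NavierStokesRegularity.NavierStokesRegularity.Theorems.TerminalTraceTypeITraceScarL3NoQuietShellExtinctApex
import Summits.NavierStokesRegularity.NavierStokesRegularity.Theorems.TerminalTraceTypeITraceScarL3StubCentreEnstrophyAtDepth
import Summits.NavierStokesRegularity.NavierStokesRegularity.Theorems.TerminalTraceTypeITraceScarL3ApexPackageTranslate
import Summits.NavierStokesRegularity.NavierStokesRegularity.Theorems.TerminalTraceTypeITraceScarL3StripRepresentative

/-!
# Route QuarterBudgetTrace — support `NoBudgetedExtinctApex` (stmt-NavierStokesRegularity-26015):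
# NO BUDGETED EXTINCT TYPE-I APEX IS SINGULAR AT ITS APEX (packing of the depth enstrophy floor)

Seat ns-es-p1 g3 (director-ns KEY-NS #81 (1)); planner of record ns-idea-9 g2 (route header §«#9 NoBudgetedExtinctApex»,
critic idea-crit-8 V20 price P2 «S2 first»).

THE STATEMENT (`…Theses.QuarterBudgetTrace.NoBudgetedExtinctApex`, proved here BY NAME as `noBudgetedExtinctApex`): an
extinct Type-I apex package `(U, P, G)` of class `(M, D₀, C)` — suitable weak in every `Q_a(0,0)`, weak spatial gradient `G`
on every `Q_a`, `typeIBound ≤ M`, plain pressure bound `cknD ≤ D₀` below `t = 0`, sup rate `‖U(s)‖ ≤ C/√(−s)` a.e., weak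
nullity of `U(s)` as `s ↑ 0` — which moreover carries the SLAB ENSTROPHY BUDGET `∫∫_{(−r²,0)×ℝ³} ‖G‖² ≤ K′ r` for every `r > 0`,
is NOT backward-singular at the origin.

PROOF (the planner's PACKING plan, all bricks landed under `TerminalTrace.TypeITraceScarL3`, stmt-18385):
1. If the origin were apex-singular, the apex-time singular set `Σ₀ = {x : (0,x) singular}` would be uncountable
   (`not_countable_topSingularSet_of_quietShellExclusion` with `hQA := no_quietShellExtinctApex`), in particular infinite: pick
   `N` points of `Σ₀`, `N > 16√2·K′⁺/(κ₀c₂)`, pairwise `2r`-separated (`r` = half the least mutual distance).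
2. With `T₁ = r²`, the class-uniform depth floor `stub_centreEnstrophyAtDepth` (constants `κ₀, c₂` of the class), applied to
   the TRANSLATED package at each of the `N` points (`apexPackage_translate`, `isBackwardSingularPoint_translate_zero_iff`) and to
   the translate of ONE strip representative `V` of `U` on `]−2T₁, −T₁/4[ × ℝ³` (`exists_strip_representative_of_apex`), gives a
   time window of length `c₂T₁` inside the strip on which `∫_{B(xᵢ,r)} |curl V(t)|² ≥ κ₀ T₁^{−1/2}`; integrating (Tonelli),
   `∫∫_{strip ∩ (ℝ × B(xᵢ,r))} |curl V|² ≥ κ₀ c₂ r` for each `i`.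
3. The balls are disjoint, `|curl V|² ≤ 16 ‖∇V‖²` pointwise (`norm_curl_le_four_mul`), and `∇V = G` a.e. on the strip (the
   classical slice gradient of the representative is a weak gradient, `hasWeakSpatialGradientOn_of_hasFDerivAt`; weak gradients
   are a.e. unique, `HasWeakSpatialGradientOn.ae_eq`); the strip lies in `(−(√2 r)², 0) × ℝ³`, so the budget gives
   `N κ₀ c₂ r ≤ 16 · K′ · √2 r`, i.e. `N ≤ 16√2 K′/(κ₀c₂)` — contradiction.

* `setLIntegral_ball_comp_add_right` — bookkeeping: `∫⁻_{B(0,r)} g(y + x) dy = ∫⁻_{B(x,r)} g`.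
* `noBudgetedExtinctApex` — the item, by name.

WHAT THIS IS NOT: not a proof of Navier–Stokes regularity and not progress on the route's two OPEN cruxes (`EnstrophyQuarterLaw`
stmt-1574, `NoTraceConcentration` stmt-18381 — both consequences of regularity used toward it); it is the unconditional support
«LOUD ∩ BUDGET = ∅»: a statement about HYPOTHETICAL budgeted extinct Type-I blow-up limits.  No summit statement is proved here.
-/

noncomputable section

-- the summit and its single sub-problem share the name (CONVENTIONS §1), as in every Theorems file
set_option linter.dupNamespace false

namespace Summit.NavierStokesRegularity.NavierStokesRegularity.Theorems.QuarterBudgetTraceNoBudgetedExtinctApex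

open MeasureTheory Set Function Filter Topology Metric
open scoped NNReal ENNReal InnerProductSpace RealInnerProductSpace
open Literature.Analysis Literature.Analysis.FluidPDE
open Summit.NavierStokesRegularity.NavierStokesRegularity.Theorems.TypeITraceScarL3

/-- Bookkeeping: a set lower Lebesgue integral over the ball `B(0, r)` of a translate `y ↦ g(y + x)` is the integral of `g`
over `B(x, r)` (Lebesgue measure is translation invariant). -/
theorem setLIntegral_ball_comp_add_right (g : EuclideanSpace ℝ (Fin 3) → ℝ≥0∞) (x : EuclideanSpace ℝ (Fin 3)) (r : ℝ) :
    ∫⁻ y in ball (0 : EuclideanSpace ℝ (Fin 3)) r, g (y + x) = ∫⁻ y in ball x r, g y := by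
  have hmp : MeasurePreserving (fun y : EuclideanSpace ℝ (Fin 3) => y + x) volume volume :=
    measurePreserving_add_right volume x
  have hemb : MeasurableEmbedding (fun y : EuclideanSpace ℝ (Fin 3) => y + x) :=
    (Homeomorph.addRight x).measurableEmbedding
  have hpre : (fun y : EuclideanSpace ℝ (Fin 3) => y + x) ⁻¹' (ball x r) = ball 0 r := by
    ext y
    simp [mem_ball, dist_eq_norm]
  rw [← hpre]
  exact hmp.setLIntegral_comp_preimage_emb hemb g (ball x r)

/-- **`NoBudgetedExtinctApex` (stmt-NavierStokesRegularity-26015), BY NAME.**  No budgeted extinct Type-I apex is singular at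
its apex: the six-clause apex package of class `(M, D₀, C)` plus the slab enstrophy budget `∫⁻_{(−r²,0)×ℝ³} ‖G‖ₑ² ≤ K′ r`
(all `r > 0`) give `¬ IsBackwardSingularPoint U 0`.  Packing of the class-uniform depth enstrophy floor against the budget versus
uncountability of the apex-time singular set (module docstring). -/
theorem noBudgetedExtinctApex :
    Summit.NavierStokesRegularity.NavierStokesRegularity.Theses.QuarterBudgetTrace.NoBudgetedExtinctApex := by
  intro M D₀ C K' U P G hsw hG hI hD hrate htop hbud hsing
  classical
  -- ### 0. the class constants and the infinite apex-time singular set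
  obtain ⟨κ₀, hκ₀, c₂, hc₂, hc₂h, hQ1⟩ := stub_centreEnstrophyAtDepth M D₀ C
  obtain ⟨A₀, hA₀, hQA⟩ := no_quietShellExtinctApex M D₀ C
  have hunc := not_countable_topSingularSet_of_quietShellExclusion hA₀ hQA hsw hG hI hD hrate htop hsing
  set Sing : Set (EuclideanSpace ℝ (Fin 3)) :=
    {x : EuclideanSpace ℝ (Fin 3) | IsBackwardSingularPoint U ((0 : ℝ), x)} with hSing
  have hinf : Sing.Infinite := fun hfin => hunc hfin.countable
  -- ### 1. `N` separated singular points, `N` beyond the packing number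
  set B : ℝ := 16 * Real.sqrt 2 * max K' 0 / (κ₀ * c₂) with hBdef
  obtain ⟨N₀, hN₀⟩ := exists_nat_gt B
  set N : ℕ := N₀ + 2 with hNdef
  have hNB : B < N := by
    have : (N₀ : ℝ) ≤ N := by rw [hNdef]; push_cast; linarith
    exact hN₀.trans_le this
  obtain ⟨S, hSsub, hScard⟩ := hinf.exists_subset_card_eq N
  have hS1 : 1 < S.card := by rw [hScard, hNdef]; omega
  obtain ⟨a₀, ha₀, b₀, hb₀, hab₀⟩ := Finset.one_lt_card.1 hS1
  have hoff : S.offDiag.Nonempty := ⟨(a₀, b₀), Finset.mem_offDiag.2 ⟨ha₀, hb₀, hab₀⟩⟩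
  obtain ⟨p₀, hp₀, hmin⟩ := S.offDiag.exists_min_image (fun p => dist p.1 p.2) hoff
  set δ : ℝ := dist p₀.1 p₀.2 with hδdef
  have hδ : 0 < δ := dist_pos.2 (Finset.mem_offDiag.1 hp₀).2.2
  have hsep : ∀ x ∈ S, ∀ y ∈ S, x ≠ y → δ ≤ dist x y := fun x hx y hy hxy =>
    hmin (x, y) (Finset.mem_offDiag.2 ⟨hx, hy, hxy⟩)
  -- ### 2. the scale: `r = δ/2`, `T₁ = r²`
  set r : ℝ := δ / 2 with hrdef
  have hr : 0 < r := by positivity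
  set T₁ : ℝ := r ^ 2 with hT₁def
  have hT₁ : 0 < T₁ := by positivity
  have hsqrt : Real.sqrt T₁ = r := by rw [hT₁def, Real.sqrt_sq hr.le]
  have hTpow : T₁ ^ (-(1 / 2 : ℝ)) = r⁻¹ := by
    rw [Real.rpow_neg hT₁.le, ← Real.sqrt_eq_rpow, hsqrt]
  set r' : ℝ := Real.sqrt 2 * r with hr'def
  have hr' : 0 < r' := by positivity
  have hr'sq : r' ^ 2 = 2 * T₁ := by
    rw [hr'def, mul_pow, Real.sq_sqrt (by norm_num : (0 : ℝ) ≤ 2), hT₁def]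
  -- ### 3. the strip and ONE smooth representative on it
  set I : Set ℝ := Ioo (-2 * T₁) (-T₁ / 4) with hIdef
  set Ω : Set (ℝ × EuclideanSpace ℝ (Fin 3)) := I ×ˢ (univ : Set (EuclideanSpace ℝ (Fin 3))) with hΩdef
  have hΩm : MeasurableSet Ω := measurableSet_Ioo.prod MeasurableSet.univ
  have hb4 : -T₁ / 4 < 0 := by linarith
  obtain ⟨K, V, hVU, hVc, hCD, hjc, -, -, -, -, -⟩ :=
    exists_strip_representative_of_apex hsw hD hrate (a := -2 * T₁) (b := -T₁ / 4) hb4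
  have hC1 : ∀ t ∈ I, ContDiff ℝ 1 (V t) := fun t ht =>
    contDiff_iff_contDiffAt.2 fun y =>
      (hCD (t, y) ⟨ht, mem_univ _⟩).of_le (by exact_mod_cast le_top)
  have hfdc : ContinuousOn (fun z : ℝ × EuclideanSpace ℝ (Fin 3) => fderiv ℝ (V z.1) z.2) Ω :=
    continuousOn_fderiv_of_continuousOn_iteratedFDeriv_one (hjc 1)
  -- the integrand
  set F : ℝ × EuclideanSpace ℝ (Fin 3) → ℝ≥0∞ := fun z => (‖curl (V z.1) z.2‖ₑ) ^ 2 with hFdef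
  have hcurlc : ContinuousOn (fun z : ℝ × EuclideanSpace ℝ (Fin 3) => curl (V z.1) z.2) Ω :=
    (curlCLM.continuous.comp_continuousOn hfdc).congr fun z _ => by
      simp only [comp_apply, curl_eq_curlCLM]
  have hFc : ContinuousOn F Ω :=
    (ENNReal.continuous_pow 2).comp_continuousOn (continuous_enorm.comp_continuousOn hcurlc)
  -- ### 4. identification `∇V = G` a.e. on the strip
  have hident : ∀ᵐ z ∂(volume.restrict Ω), fderiv ℝ (V z.1) z.2 = G z.1 z.2 := by
    have hΩU : Ω = ⋃ n : ℕ, I ×ˢ ball (0 : EuclideanSpace ℝ (Fin 3)) (n + 1) := by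
      rw [hΩdef, ← prod_iUnion, iUnion_ball_nat_succ]
    rw [hΩU, ae_restrict_iUnion_iff]
    intro n
    set O : Set (ℝ × EuclideanSpace ℝ (Fin 3)) := I ×ˢ ball (0 : EuclideanSpace ℝ (Fin 3)) (n + 1) with hOdef
    have hOo : IsOpen O := isOpen_Ioo.prod isOpen_ball
    have hOΩ : O ⊆ Ω := prod_mono Subset.rfl (subset_univ _)
    set Oop : TopologicalSpace.Opens (ℝ × EuclideanSpace ℝ (Fin 3)) := ⟨O, hOo⟩ with hOop
    have hVgrad : HasWeakSpatialGradientOn Oop V (fun t x => fderiv ℝ (V t) x) :=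
      hasWeakSpatialGradientOn_of_hasFDerivAt (S := I) (Q := Oop) hOΩ hVc hfdc
        fun t ht y => ((hCD (t, y) ⟨ht, mem_univ _⟩).differentiableAt (by simp)).hasFDerivAt
    -- a backward cylinder about the origin containing `O`
    set a : ℝ := (n + 1 : ℝ) + r' with hadef
    have ha : 0 < a := by positivity
    have hOQ : O ⊆ parabolicCylinder a (0 : ℝ × EuclideanSpace ℝ (Fin 3)) := by
      intro z hz
      obtain ⟨hz1, hz2⟩ := mem_prod.1 hz
      rw [hIdef, mem_Ioo] at hz1
      rw [mem_ball] at hz2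
      rw [mem_parabolicCylinder]
      have h1 : r' ^ 2 ≤ a ^ 2 := by
        apply pow_le_pow_left₀ hr'.le
        rw [hadef]; linarith [(by positivity : (0 : ℝ) ≤ (n : ℝ) + 1)]
      refine ⟨⟨?_, ?_⟩, ?_⟩
      · simp only [Prod.fst_zero]; nlinarith [hz1.1]
      · simp only [Prod.fst_zero]; linarith [hz1.2]
      · simp only [Prod.snd_zero]
        have : (n : ℝ) + 1 ≤ a := by rw [hadef]; linarith
        exact hz2.trans_le this
    have hGO : HasWeakSpatialGradientOn Oop U G :=
      (hG a ha).mono (show Oop ≤ parabolicCylinderOpens a (0 : ℝ × EuclideanSpace ℝ (Fin 3)) from hOQ)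
    have hVG : HasWeakSpatialGradientOn Oop V G := by
      refine hGO.congr_ae ?_
      have h1 : uncurry V =ᵐ[volume.restrict O] uncurry U := ae_restrict_of_ae_restrict_of_subset hOΩ hVU
      exact h1.symm
    have hae := HasWeakSpatialGradientOn.ae_eq hVgrad hVG
    filter_upwards [hae] with z hz
    exact hz
  -- ### 5. the pointwise curl bound and the budget side
  have hpt : ∀ z : ℝ × EuclideanSpace ℝ (Fin 3), F z ≤ 16 * (‖fderiv ℝ (V z.1) z.2‖ₑ) ^ 2 := by
    intro z
    have h := norm_curl_le_four_mul (V z.1) z.2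
    have h' : (‖curl (V z.1) z.2‖ₑ : ℝ≥0∞) ≤ ENNReal.ofReal 4 * ‖fderiv ℝ (V z.1) z.2‖ₑ := by
      rw [← ofReal_norm, ← ofReal_norm, ← ENNReal.ofReal_mul (by norm_num)]
      exact ENNReal.ofReal_le_ofReal h
    calc F z = (‖curl (V z.1) z.2‖ₑ) ^ 2 := rfl
      _ ≤ (ENNReal.ofReal 4 * ‖fderiv ℝ (V z.1) z.2‖ₑ) ^ 2 := by gcongr
      _ = 16 * (‖fderiv ℝ (V z.1) z.2‖ₑ) ^ 2 := by
          rw [mul_pow, ENNReal.ofReal_ofNat]; norm_num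
  have hΩsub : Ω ⊆ Ioo (-(r' ^ 2)) 0 ×ˢ (univ : Set (EuclideanSpace ℝ (Fin 3))) := by
    intro z hz
    obtain ⟨hz1, -⟩ := mem_prod.1 hz
    rw [hIdef, mem_Ioo] at hz1
    refine mem_prod.2 ⟨⟨?_, ?_⟩, mem_univ _⟩
    · rw [hr'sq]; linarith [hz1.1]
    · linarith [hz1.2]
  have hupper : ∫⁻ z in Ω, F z ≤ 16 * ENNReal.ofReal (K' * r') := by
    calc ∫⁻ z in Ω, F z ≤ ∫⁻ z in Ω, 16 * (‖fderiv ℝ (V z.1) z.2‖ₑ) ^ 2 := lintegral_mono fun z => hpt z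
      _ = 16 * ∫⁻ z in Ω, (‖fderiv ℝ (V z.1) z.2‖ₑ) ^ 2 := lintegral_const_mul' _ _ (by norm_num)
      _ = 16 * ∫⁻ z in Ω, (‖G z.1 z.2‖ₑ) ^ 2 := by
          congr 1
          refine lintegral_congr_ae ?_
          filter_upwards [hident] with z hz
          rw [hz]
      _ ≤ 16 * ∫⁻ z in Ioo (-(r' ^ 2)) 0 ×ˢ (univ : Set (EuclideanSpace ℝ (Fin 3))), (‖G z.1 z.2‖ₑ) ^ 2 :=
          mul_le_mul_right (lintegral_mono_set hΩsub) _
      _ ≤ 16 * ENNReal.ofReal (K' * r') := by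
          gcongr
          exact hbud r' hr'
  -- ### 6. the floor on each ball, integrated over the strip
  have hlower : ∀ x ∈ S, ENNReal.ofReal (κ₀ * c₂ * r) ≤ ∫⁻ z in I ×ˢ ball x r, F z := by
    intro x hx
    have hxsing : IsBackwardSingularPoint U ((0 : ℝ), x) := hSsub (Finset.mem_coe.2 hx)
    -- the translated package is singular at the origin
    obtain ⟨hsw', hG', hI', hD', hrate', htop'⟩ := apexPackage_translate x hsw hG hI hD hrate htop
    have hsing' : IsBackwardSingularPoint (fun s y => U s (y + x)) (0 : ℝ × EuclideanSpace ℝ (Fin 3)) :=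
      (isBackwardSingularPoint_translate_zero_iff x U).2 hxsing
    obtain ⟨t₁, ht₁, hfloor⟩ := hQ1 _ _ _ hsw' hG' hI' hD' hrate' htop' hsing' T₁ hT₁
    -- the translated representative
    set τ : ℝ × EuclideanSpace ℝ (Fin 3) → ℝ × EuclideanSpace ℝ (Fin 3) := fun z => (z.1, z.2 + x) with hτdef
    have hτc : Continuous τ := continuous_fst.prodMk (continuous_snd.add continuous_const)
    have hτΩ : MapsTo τ Ω Ω := fun z hz => mem_prod.2 ⟨(mem_prod.1 hz).1, mem_univ _⟩
    have hpre : τ ⁻¹' Ω = Ω := by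
      ext z
      simp only [hτdef, hΩdef, mem_preimage, mem_prod, mem_univ, and_true]
    have hVxU : uncurry (fun s y => V s (y + x)) =ᵐ[volume.restrict Ω] uncurry (fun s y => U s (y + x)) := by
      have h := ae_restrict_comp_translate x hΩm hVU
      rw [hpre] at h
      filter_upwards [h] with z hz
      exact hz
    have hVxc : ContinuousOn (uncurry fun s y => V s (y + x)) Ω :=
      (hVc.comp hτc.continuousOn hτΩ).congr fun z _ => rfl
    have hVxC1 : ∀ t ∈ I, ContDiff ℝ 1 ((fun s y => V s (y + x)) t) := fun t ht =>
      (hC1 t ht).comp (contDiff_id.add contDiff_const)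
    have hfl := hfloor (fun s y => V s (y + x)) hVxU hVxc hVxC1
    -- the window
    set W : Set ℝ := Icc (t₁ - c₂ * T₁) t₁ with hWdef
    have hWI : W ⊆ I := by
      intro t ht
      rw [hWdef, mem_Icc] at ht
      rw [hIdef, mem_Ioo]
      rw [mem_Icc] at ht₁
      constructor <;> nlinarith [ht.1, ht.2, ht₁.1, ht₁.2]
    have hvolW : volume W = ENNReal.ofReal (c₂ * T₁) := by
      rw [hWdef, Real.volume_Icc]; ring_nf
    -- the floor at each window time, in `ℝ≥0∞` on the ball `B(x, r)`
    have hslice : ∀ t ∈ W, ENNReal.ofReal (κ₀ * T₁ ^ (-(1 / 2 : ℝ))) ≤ ∫⁻ y in ball x r, F (t, y) := by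
      intro t ht
      have h1 := hfl t ht
      rw [hsqrt] at h1
      have hcurl : ∀ y, curl ((fun s y => V s (y + x)) t) y = curl (V t) (y + x) := fun y =>
        curl_comp_add_const (V t) x y
      simp_rw [hcurl] at h1
      -- integrability (the floor is positive)
      have hint : Integrable (fun y => ‖curl (V t) (y + x)‖ ^ 2)
          (volume.restrict (ball (0 : EuclideanSpace ℝ (Fin 3)) r)) := by
        by_contra hni
        rw [integral_undef hni] at h1
        exact absurd h1 (not_le.2 (by positivity))
      have h2 : ENNReal.ofReal (∫ y in ball (0 : EuclideanSpace ℝ (Fin 3)) r, ‖curl (V t) (y + x)‖ ^ 2) =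
          ∫⁻ y in ball (0 : EuclideanSpace ℝ (Fin 3)) r, F (t, y + x) := by
        rw [ofReal_integral_eq_lintegral_ofReal hint (ae_of_all _ fun y => sq_nonneg _)]
        refine lintegral_congr fun y => ?_
        simp only [hFdef]
        rw [ENNReal.ofReal_pow (norm_nonneg _), ofReal_norm]
      calc ENNReal.ofReal (κ₀ * T₁ ^ (-(1 / 2 : ℝ)))
          ≤ ENNReal.ofReal (∫ y in ball (0 : EuclideanSpace ℝ (Fin 3)) r, ‖curl (V t) (y + x)‖ ^ 2) :=
            ENNReal.ofReal_le_ofReal h1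
        _ = ∫⁻ y in ball (0 : EuclideanSpace ℝ (Fin 3)) r, F (t, y + x) := h2
        _ = ∫⁻ y in ball x r, F (t, y) := setLIntegral_ball_comp_add_right (fun y => F (t, y)) x r
    -- Tonelli on `W × B(x, r)`
    have hWB : W ×ˢ ball x r ⊆ Ω := prod_mono hWI (subset_univ _)
    have hFae : AEMeasurable F ((volume : Measure (ℝ × EuclideanSpace ℝ (Fin 3))).restrict (W ×ˢ ball x r)) :=
      (hFc.mono hWB).aemeasurable (measurableSet_Icc.prod measurableSet_ball)
    have hprod : ∫⁻ z in W ×ˢ ball x r, F z = ∫⁻ t in W, ∫⁻ y in ball x r, F (t, y) := by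
      have h := setLIntegral_prod (μ := (volume : Measure ℝ)) (ν := (volume : Measure (EuclideanSpace ℝ (Fin 3))))
        (s := W) (t := ball x r) F (by rw [← Measure.volume_eq_prod]; exact hFae)
      rw [← Measure.volume_eq_prod] at h
      exact h
    calc ENNReal.ofReal (κ₀ * c₂ * r)
        = ENNReal.ofReal (κ₀ * T₁ ^ (-(1 / 2 : ℝ))) * volume W := by
          rw [hvolW, hTpow, ← ENNReal.ofReal_mul (by positivity)]
          congr 1
          rw [hT₁def]; field_simp
      _ = ∫⁻ _t in W, ENNReal.ofReal (κ₀ * T₁ ^ (-(1 / 2 : ℝ))) := (setLIntegral_const _ _).symm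
      _ ≤ ∫⁻ t in W, ∫⁻ y in ball x r, F (t, y) := setLIntegral_mono' measurableSet_Icc hslice
      _ = ∫⁻ z in W ×ˢ ball x r, F z := hprod.symm
      _ ≤ ∫⁻ z in I ×ˢ ball x r, F z := lintegral_mono_set (prod_mono hWI Subset.rfl)
  -- ### 7. summation over the disjoint balls
  have hdisj : (S : Set (EuclideanSpace ℝ (Fin 3))).PairwiseDisjoint
      (fun x => I ×ˢ ball x r) := by
    intro x hx y hy hxy
    have hd : δ ≤ dist x y := hsep x (Finset.mem_coe.1 hx) y (Finset.mem_coe.1 hy) hxy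
    have hrr : r + r ≤ dist x y := by rw [hrdef]; linarith
    show Disjoint (I ×ˢ ball x r) (I ×ˢ ball y r)
    exact Set.disjoint_prod.2 (Or.inr (ball_disjoint_ball hrr))
  have hUsub : (⋃ x ∈ S, I ×ˢ ball x r) ⊆ Ω :=
    iUnion₂_subset fun x _ => prod_mono Subset.rfl (subset_univ _)
  have hsum : (N : ℝ≥0∞) * ENNReal.ofReal (κ₀ * c₂ * r) ≤ ∫⁻ z in Ω, F z := by
    calc (N : ℝ≥0∞) * ENNReal.ofReal (κ₀ * c₂ * r)
        = ∑ x ∈ S, ENNReal.ofReal (κ₀ * c₂ * r) := by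
          rw [Finset.sum_const, hScard, nsmul_eq_mul]
      _ ≤ ∑ x ∈ S, ∫⁻ z in I ×ˢ ball x r, F z := Finset.sum_le_sum hlower
      _ = ∫⁻ z in ⋃ x ∈ S, I ×ˢ ball x r, F z :=
          (lintegral_biUnion_finset hdisj (fun x _ => measurableSet_Ioo.prod measurableSet_ball) F).symm
      _ ≤ ∫⁻ z in Ω, F z := lintegral_mono_set hUsub
  -- ### 8. the contradiction `N κ₀ c₂ r ≤ 16 K′ √2 r`
  have key : ENNReal.ofReal ((N : ℝ) * (κ₀ * c₂ * r)) ≤ ENNReal.ofReal (16 * (K' * r')) := by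
    rw [ENNReal.ofReal_mul (Nat.cast_nonneg _), ENNReal.ofReal_natCast,
      ENNReal.ofReal_mul (by norm_num : (0 : ℝ) ≤ 16), ENNReal.ofReal_ofNat]
    exact hsum.trans hupper
  have hpos : 0 < (N : ℝ) * (κ₀ * c₂ * r) := by positivity
  rcases ENNReal.ofReal_le_ofReal_iff'.1 key with hle | hle
  · -- `N κ₀ c₂ ≤ 16 √2 K′ ≤ 16 √2 K′⁺`, against `B < N`
    have h1 : (N : ℝ) * (κ₀ * c₂) ≤ 16 * Real.sqrt 2 * K' := by
      have h2 : (N : ℝ) * (κ₀ * c₂) * r ≤ 16 * Real.sqrt 2 * K' * r := by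
        calc (N : ℝ) * (κ₀ * c₂) * r = (N : ℝ) * (κ₀ * c₂ * r) := by ring
          _ ≤ 16 * (K' * r') := hle
          _ = 16 * Real.sqrt 2 * K' * r := by rw [hr'def]; ring
      exact le_of_mul_le_mul_right h2 hr
    have h3 : (N : ℝ) * (κ₀ * c₂) ≤ 16 * Real.sqrt 2 * max K' 0 :=
      h1.trans (by gcongr; exact le_max_left _ _)
    have hκc : 0 < κ₀ * c₂ := mul_pos hκ₀ hc₂
    have h4 : (N : ℝ) ≤ B := by
      rw [hBdef, le_div_iff₀ hκc]
      exact h3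
    linarith
  · exact absurd hle (not_le.2 hpos)

end Summit.NavierStokesRegularity.NavierStokesRegularity.Theorems.QuarterBudgetTraceNoBudgetedExtinctApex

end
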